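import Literature.Probability.RandomPlanarGeometry.PolygonalDomains
import HarnessLib

/-!
# Crux `BoundaryClosureR` (stmt-CriticalPhenomena-14004), line `polygon-parity-squeeze`,
# stub `stub_innerPolygons` (IP): the complement of a Jordan domain stays connected when a
# window below a flat boundary piece is removed

Landing target:
`Summits/CriticalPhenomena/SAWScalingLimit/Theorems/SAWDefectDecoherenceBoundaryClosureRInnerPolygonsComplement.lean`
(`--supports stmt-CriticalPhenomena-14004`; building block of the registered stub `stub_innerPolygons`,
hypothesis (IP) of the landed squeeze `PolygonParitySqueeze.squeeze_of_innerPolygons`).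

The inner exact polygon `P` of the squeeze touches `∂Ω` exactly along the two flat pin segments
(gate at `pt 1`, root at `pt 0`).  To see that the inside of its boundary polygon `γ` lies in `Ω`
one argues: `γ ⊆ Ω ∪ W₁ ∪ W₀` for two open windows `W_i` around the pin segments, and
`ℂ ∖ (Ω ∪ W₁ ∪ W₀) = Ωᶜ ∖ W₁ ∖ W₀` is CONNECTED and UNBOUNDED, hence lies in the outside of `γ`.
This file proves that connectedness (pure plane topology, from the Jordan curve theorem proved in
the tree through `JordanDomain.exists_outside`):

* `isPreconnected_diff_of_closure_inter` — **cutting lemma**: for a closed preconnected `X`, an open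
  `O` and a preconnected `A ⊆ X ∖ O` containing `closure (X ∩ O) ∩ (X ∖ O)` (the rim of the hole),
  `X ∖ O` is preconnected;
* `isPreconnected_diff_window` — for a closed preconnected `X` which inside `ball x r` is the closed
  lower half-ball (`X ∩ ball x r = {im ≤ im x} ∩ ball x r`), removing the open window
  `{|re(z - x)| < a, |im(z - x)| < b}` (`a + b < r`) keeps it preconnected (the rim is a `⊔`-shaped
  union of three segments inside `X`);
* `compl_carrier_eq_closure_outside`, `isConnected_compl_carrier` — the complement of the carrier of
  a Jordan domain is the closure of its outside: closed, connected, unbounded;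
* `isConnected_compl_carrier_diff_window`, `isConnected_compl_carrier_diff_two_windows` — **the
  complement of a Dobrushin carrier minus one / two windows below flat boundary pieces is connected
  and unbounded** (the form the inner-polygon construction consumes, windows at `pt 1` and `pt 0`).

Sources: J. McCleary, *A First Course in Topology* (2006), Ch. 9 (Jordan curve theorem; tree:
`JordanCurveTheorem_holds`, `JordanDomain.exists_outside`).  No definition and no named fact is
introduced.
-/

noncomputable section

open Set Metric
open Literature.Probability.RandomPlanarGeometry

namespace Summit.CriticalPhenomena.SAWScalingLimit.Theorems.PolygonParitySqueeze

/-! ### 1. The cutting lemma -/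

/-- **Cutting lemma.** Let `X` be closed and preconnected, `O` open, and `A ⊆ X ∖ O` preconnected
with `closure (X ∩ O) ∩ (X ∖ O) ⊆ A` (the rim of the removed part lies in `A`).  Then `X ∖ O` is
preconnected: a clopen splitting of `X ∖ O` has `A` on one side, and adding `closure (X ∩ O)` to that
side splits `X`. [folklore] -/
theorem isPreconnected_diff_of_closure_inter {X O A : Set ℂ} (hX : IsPreconnected X) (hXc : IsClosed X)
    (hO : IsOpen O) (hA : IsPreconnected A) (hAS : A ⊆ X \ O)
    (hfr : closure (X ∩ O) ∩ (X \ O) ⊆ A) : IsPreconnected (X \ O) := by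
  have hSc : IsClosed (X \ O) := hXc.sdiff hO
  rw [isPreconnected_iff_subset_of_fully_disjoint_closed hSc]
  -- key step: `A` on the `u`-side
  have key : ∀ u v : Set ℂ, IsClosed u → IsClosed v → X \ O ⊆ u ∪ v → Disjoint u v → A ⊆ u →
      X \ O ⊆ u ∨ X \ O ⊆ v := by
    intro u v hu hv hSuv huv hAu
    have hXsub : X ⊆ ((X \ O) ∩ u ∪ closure (X ∩ O)) ∪ (X \ O) ∩ v := by
      intro z hz
      by_cases hzO : z ∈ O
      · exact Or.inl (Or.inr (subset_closure ⟨hz, hzO⟩))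
      · rcases hSuv ⟨hz, hzO⟩ with h | h
        · exact Or.inl (Or.inl ⟨⟨hz, hzO⟩, h⟩)
        · exact Or.inr ⟨⟨hz, hzO⟩, h⟩
    have hdisj : Disjoint ((X \ O) ∩ u ∪ closure (X ∩ O)) ((X \ O) ∩ v) := by
      rw [Set.disjoint_union_left]
      exact ⟨Set.disjoint_left.2 fun z hz hz' => Set.disjoint_left.1 huv hz.2 hz'.2,
        Set.disjoint_left.2 fun z hz hz' => Set.disjoint_left.1 huv (hAu (hfr ⟨hz, hz'.1⟩)) hz'.2⟩
    rcases (isPreconnected_iff_subset_of_fully_disjoint_closed hXc).1 hX _ _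
      ((hSc.inter hu).union isClosed_closure) (hSc.inter hv) hXsub hdisj with h | h
    · left
      intro z hz
      rcases h hz.1 with h' | h'
      · exact h'.2
      · exact hAu (hfr ⟨h', hz⟩)
    · exact Or.inr fun z hz => (h hz.1).2
  intro u v hu hv hSuv huv
  have hAuv : A ⊆ u ∨ A ⊆ v :=
    isPreconnected_iff_subset_of_disjoint_closed.1 hA u v hu hv (hAS.trans hSuv)
      (by rw [Set.disjoint_iff_inter_eq_empty.1 huv, Set.inter_empty])
  rcases hAuv with hAu | hAv
  · exact key u v hu hv hSuv huv hAu
  · rw [Set.union_comm] at hSuv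
    exact (key v u hv hu hSuv huv.symm hAv).symm

/-! ### 2. Removing a window below a flat piece -/

/-- A point whose coordinates relative to `x` are bounded by `a` and `b` in absolute value lies in
`ball x r` once `a + b < r`. [folklore] -/
theorem mem_ball_of_abs_re_im_le {x z : ℂ} {a b r : ℝ} (hre : |(z - x).re| ≤ a) (him : |(z - x).im| ≤ b)
    (hr : a + b < r) : z ∈ ball x r := by
  rw [Metric.mem_ball, dist_eq_norm]
  exact lt_of_le_of_lt ((Complex.norm_le_abs_re_add_abs_im _).trans (add_le_add hre him)) hr

/-- **Removing a window below a flat piece keeps a closed connected set connected.** Let `X` be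
closed and preconnected with `X ∩ ball x r = {z | im z ≤ im x} ∩ ball x r` (inside the ball, `X` is
the closed lower half), `0 < a`, `0 < b`, `a + b < r`.  Then `X` minus the open window
`{z | |re(z - x)| < a ∧ |im(z - x)| < b}` is preconnected: the rim of the window inside `X` is the
`⊔`-shaped union of the segments `re = ∓a, -b ≤ im ≤ 0` and `im = -b, |re| ≤ a` (relative to `x`),
three convex sets chained at the two lower corners, inside `X`. [folklore] -/
theorem isPreconnected_diff_window {X : Set ℂ} (hX : IsPreconnected X) (hXc : IsClosed X) {x : ℂ}
    {r a b : ℝ} (ha : 0 < a) (hb : 0 < b) (hr : a + b < r)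
    (hflat : X ∩ ball x r = {z : ℂ | z.im ≤ x.im} ∩ ball x r) :
    IsPreconnected (X \ {z : ℂ | |(z - x).re| < a ∧ |(z - x).im| < b}) := by
  set O : Set ℂ := {z : ℂ | |(z - x).re| < a ∧ |(z - x).im| < b} with hOdef
  -- the rim: left, bottom, right
  set A₁ : Set ℂ := {z : ℂ | (z - x).re = -a ∧ -b ≤ (z - x).im ∧ (z - x).im ≤ 0} with hA₁
  set A₂ : Set ℂ := {z : ℂ | |(z - x).re| ≤ a ∧ (z - x).im = -b} with hA₂
  set A₃ : Set ℂ := {z : ℂ | (z - x).re = a ∧ -b ≤ (z - x).im ∧ (z - x).im ≤ 0} with hA₃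
  have hO : IsOpen O := by
    have h1 : Continuous fun z : ℂ => |(z - x).re| := by fun_prop
    have h2 : Continuous fun z : ℂ => |(z - x).im| := by fun_prop
    exact (isOpen_lt h1 continuous_const).inter (isOpen_lt h2 continuous_const)
  -- membership in `X` of points of the closed lower half-ball
  have memX : ∀ z : ℂ, |(z - x).re| ≤ a → |(z - x).im| ≤ b → (z - x).im ≤ 0 → z ∈ X := by
    intro z hre him hle
    have hz : z ∈ {z : ℂ | z.im ≤ x.im} ∩ ball x r :=
      ⟨by have := Complex.sub_im z x; simp only [Set.mem_setOf_eq]; linarith,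
        mem_ball_of_abs_re_im_le hre him hr⟩
    rw [← hflat] at hz
    exact hz.1
  -- convexity of the three rim pieces
  have hc₁ : Convex ℝ A₁ := by
    have e : A₁ = {z : ℂ | z.re = x.re - a} ∩ ({z : ℂ | x.im - b ≤ z.im} ∩ {z : ℂ | z.im ≤ x.im}) := by
      ext z; simp only [hA₁, Set.mem_setOf_eq, Set.mem_inter_iff, Complex.sub_re, Complex.sub_im]
      constructor
      · rintro ⟨h1, h2, h3⟩; exact ⟨by linarith, by linarith, by linarith⟩
      · rintro ⟨h1, h2, h3⟩; exact ⟨by linarith, by linarith, by linarith⟩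
    rw [e]
    exact (convex_hyperplane Complex.reLm.isLinear _).inter
      ((convex_halfSpace_ge Complex.imLm.isLinear _).inter (convex_halfSpace_le Complex.imLm.isLinear _))
  have hc₃ : Convex ℝ A₃ := by
    have e : A₃ = {z : ℂ | z.re = x.re + a} ∩ ({z : ℂ | x.im - b ≤ z.im} ∩ {z : ℂ | z.im ≤ x.im}) := by
      ext z; simp only [hA₃, Set.mem_setOf_eq, Set.mem_inter_iff, Complex.sub_re, Complex.sub_im]
      constructor
      · rintro ⟨h1, h2, h3⟩; exact ⟨by linarith, by linarith, by linarith⟩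
      · rintro ⟨h1, h2, h3⟩; exact ⟨by linarith, by linarith, by linarith⟩
    rw [e]
    exact (convex_hyperplane Complex.reLm.isLinear _).inter
      ((convex_halfSpace_ge Complex.imLm.isLinear _).inter (convex_halfSpace_le Complex.imLm.isLinear _))
  have hc₂ : Convex ℝ A₂ := by
    have e : A₂ = ({z : ℂ | x.re - a ≤ z.re} ∩ {z : ℂ | z.re ≤ x.re + a}) ∩ {z : ℂ | z.im = x.im - b} := by
      ext z; simp only [hA₂, Set.mem_setOf_eq, Set.mem_inter_iff, Complex.sub_re, Complex.sub_im, abs_le]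
      constructor
      · rintro ⟨⟨h1, h2⟩, h3⟩; exact ⟨⟨by linarith, by linarith⟩, by linarith⟩
      · rintro ⟨⟨h1, h2⟩, h3⟩; exact ⟨⟨by linarith, by linarith⟩, by linarith⟩
    rw [e]
    exact ((convex_halfSpace_ge Complex.reLm.isLinear _).inter
      (convex_halfSpace_le Complex.reLm.isLinear _)).inter (convex_hyperplane Complex.imLm.isLinear _)
  -- the two lower corners chain the pieces
  have hcornerL : x + ⟨-a, -b⟩ ∈ A₁ ∩ A₂ := by
    refine ⟨⟨by simp, by simp, by simp; linarith⟩, by simp [abs_of_pos ha], by simp⟩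
  have hcornerR : x + ⟨a, -b⟩ ∈ (A₁ ∪ A₂) ∩ A₃ := by
    refine ⟨Or.inr ⟨by simp [abs_of_pos ha], by simp⟩, by simp, by simp, by simp; linarith⟩
  have hA : IsPreconnected (A₁ ∪ A₂ ∪ A₃) :=
    ((hc₁.isPreconnected.union' ⟨_, hcornerL⟩ hc₂.isPreconnected).union' ⟨_, hcornerR⟩
      hc₃.isPreconnected)
  refine isPreconnected_diff_of_closure_inter hX hXc hO hA ?_ ?_
  · -- the rim lies in `X` and off the window
    rintro z ((⟨h1, h2, h3⟩ | ⟨h1, h2⟩) | ⟨h1, h2, h3⟩)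
    · refine ⟨memX z (by rw [h1, abs_neg, abs_of_pos ha]) (abs_le.2 ⟨by linarith, by linarith⟩) h3, ?_⟩
      rintro ⟨h, -⟩
      rw [h1, abs_neg, abs_of_pos ha] at h
      exact lt_irrefl _ h
    · refine ⟨memX z h1 (by rw [h2, abs_neg, abs_of_pos hb]) (by rw [h2]; linarith), ?_⟩
      rintro ⟨-, h⟩
      rw [h2, abs_neg, abs_of_pos hb] at h
      exact lt_irrefl _ h
    · refine ⟨memX z (by rw [h1, abs_of_pos ha]) (abs_le.2 ⟨by linarith, by linarith⟩) h3, ?_⟩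
      rintro ⟨h, -⟩
      rw [h1, abs_of_pos ha] at h
      exact lt_irrefl _ h
  · -- the rim of the window inside `X` is the `⊔`
    rintro z ⟨hzc, hzX, hzO⟩
    -- `closure (X ∩ O)` lies in the closed lower half-window
    have hsub : X ∩ O ⊆ {z : ℂ | (z - x).im ≤ 0} ∩ ({z : ℂ | |(z - x).re| ≤ a} ∩ {z : ℂ | |(z - x).im| ≤ b}) := by
      rintro w ⟨hwX, hw1, hw2⟩
      have hwball : w ∈ ball x r := mem_ball_of_abs_re_im_le hw1.le hw2.le hr
      have : w ∈ X ∩ ball x r := ⟨hwX, hwball⟩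
      rw [hflat] at this
      refine ⟨?_, hw1.le, hw2.le⟩
      have h := this.1
      simp only [Set.mem_setOf_eq] at h ⊢
      rw [Complex.sub_im]
      linarith
    have hcl : IsClosed ({z : ℂ | (z - x).im ≤ 0} ∩ ({z : ℂ | |(z - x).re| ≤ a} ∩ {z : ℂ | |(z - x).im| ≤ b})) := by
      have h0 : Continuous fun z : ℂ => (z - x).im := by fun_prop
      have h1 : Continuous fun z : ℂ => |(z - x).re| := by fun_prop
      have h2 : Continuous fun z : ℂ => |(z - x).im| := by fun_prop
      exact (isClosed_le h0 continuous_const).inter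
        ((isClosed_le h1 continuous_const).inter (isClosed_le h2 continuous_const))
    obtain ⟨him0, hre, him⟩ := (closure_minimal hsub hcl) hzc
    simp only [Set.mem_setOf_eq] at him0 hre him
    have hzO' : ¬ (|(z - x).re| < a ∧ |(z - x).im| < b) := hzO
    by_cases hre' : |(z - x).re| < a
    · -- then `|im| = b`, `im = -b`: bottom
      have himb : |(z - x).im| = b := le_antisymm him (not_lt.1 fun h => hzO' ⟨hre', h⟩)
      have : (z - x).im = -b := by
        rcases abs_eq (hb.le) |>.1 himb with h | h
        · linarith
        · exact h
      exact Or.inl (Or.inr ⟨hre, this⟩)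
    · have hrea : |(z - x).re| = a := le_antisymm hre (not_lt.1 hre')
      have himb : -b ≤ (z - x).im := (abs_le.1 him).1
      rcases (abs_eq ha.le).1 hrea with h | h
      · exact Or.inr ⟨h, himb, him0⟩
      · exact Or.inl (Or.inl ⟨h, himb, him0⟩)

/-! ### 3. The complement of a Jordan carrier -/

/-- **The complement of the carrier of a Jordan domain is the closure of its outside** (the
unbounded complementary component `V` of the boundary curve, `JordanDomain.exists_outside`):
`ℂ ∖ Ω = V ∪ ∂Ω = V ∪ ∂V = closure V`. [cite: Mccleary2006, Ch. 9 (Jordan curve theorem)] -/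
theorem compl_carrier_eq_closure_outside (D : JordanDomain) :
    ∃ V : Set ℂ, IsOpen V ∧ IsConnected V ∧ Disjoint D.carrier V ∧ ¬ Bornology.IsBounded V ∧
      frontier V = frontier D.carrier ∧ D.carrierᶜ = closure V := by
  obtain ⟨V, hVo, hVc, hDV, hunion, hfV, hVb⟩ :=
    D.exists_outside Literature.Topology.PlaneTopology.JordanCurveTheorem_holds
  refine ⟨V, hVo, hVc, hDV, hVb, hfV, ?_⟩
  rw [closure_eq_self_union_frontier, hfV]
  ext z
  constructor
  · intro hz
    by_cases hzV : z ∈ V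
    · exact Or.inl hzV
    · right
      by_contra hzf
      have : z ∈ D.carrier ∪ V := by rw [hunion]; exact hzf
      rcases this with h | h
      · exact hz h
      · exact hzV h
  · rintro (hzV | hzf) hzD
    · exact Set.disjoint_left.1 hDV hzD hzV
    · have : z ∈ (frontier D.carrier)ᶜ := by rw [← hunion]; exact Or.inl hzD
      exact this hzf

/-- **The complement of the carrier of a Jordan domain is closed, connected and unbounded.**
[cite: Mccleary2006, Ch. 9 (Jordan curve theorem)] -/
theorem isConnected_compl_carrier (D : JordanDomain) :
    IsClosed D.carrierᶜ ∧ IsConnected D.carrierᶜ ∧ ¬ Bornology.IsBounded D.carrierᶜ := by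
  obtain ⟨V, -, hVc, -, hVb, -, heq⟩ := compl_carrier_eq_closure_outside D
  refine ⟨D.isOpen.isClosed_compl, ?_, fun h => hVb (h.subset ?_)⟩
  · rw [heq]; exact hVc.closure
  · rw [heq]; exact subset_closure

/-- Inside a flat ball the complement of the carrier is the closed lower half-ball. [folklore] -/
theorem compl_carrier_inter_ball {D : JordanDomain} {x : ℂ} {r : ℝ}
    (hflat : D.carrier ∩ ball x r = {z : ℂ | x.im < z.im} ∩ ball x r) :
    D.carrierᶜ ∩ ball x r = {z : ℂ | z.im ≤ x.im} ∩ ball x r := by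
  ext z
  simp only [Set.mem_inter_iff, Set.mem_compl_iff, Set.mem_setOf_eq]
  constructor
  · rintro ⟨hz, hzb⟩
    refine ⟨not_lt.1 fun h => hz ?_, hzb⟩
    have : z ∈ {z : ℂ | x.im < z.im} ∩ ball x r := ⟨h, hzb⟩
    rw [← hflat] at this
    exact this.1
  · rintro ⟨hz, hzb⟩
    refine ⟨fun h => ?_, hzb⟩
    have : z ∈ D.carrier ∩ ball x r := ⟨h, hzb⟩
    rw [hflat] at this
    exact absurd this.1 (not_lt.2 hz)

/-- **One window** (sub-goal of `stub_innerPolygons`): for a Dobrushin domain whose carrier inside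
`ball x r` is the open upper half-ball (a flat pinned piece), removing from the complement of the
carrier the open window `{|re(z - x)| < a, |im(z - x)| < b}` (`0 < a`, `0 < b`, `a + b < r`) leaves a
CONNECTED UNBOUNDED closed set. [cite: Mccleary2006, Ch. 9 (Jordan curve theorem)] -/
theorem isConnected_compl_carrier_diff_window : ∀ (D : DobrushinDomain) (x : ℂ) (r a b : ℝ), 0 < a → 0 < b → a + b < r → D.carrier ∩ Metric.ball x r = {z : ℂ | x.im < z.im} ∩ Metric.ball x r → IsClosed (D.carrierᶜ \ {z : ℂ | |(z - x).re| < a ∧ |(z - x).im| < b}) ∧ IsConnected (D.carrierᶜ \ {z : ℂ | |(z - x).re| < a ∧ |(z - x).im| < b}) ∧ ¬ Bornology.IsBounded (D.carrierᶜ \ {z : ℂ | |(z - x).re| < a ∧ |(z - x).im| < b}) := by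
  intro D x r a b ha hb hr hflat
  obtain ⟨hXc, hXconn, hXb⟩ := isConnected_compl_carrier D.toJordanDomain
  have hO : IsOpen {z : ℂ | |(z - x).re| < a ∧ |(z - x).im| < b} := by
    have h1 : Continuous fun z : ℂ => |(z - x).re| := by fun_prop
    have h2 : Continuous fun z : ℂ => |(z - x).im| := by fun_prop
    exact (isOpen_lt h1 continuous_const).inter (isOpen_lt h2 continuous_const)
  have hOb : Bornology.IsBounded {z : ℂ | |(z - x).re| < a ∧ |(z - x).im| < b} :=
    (Metric.isBounded_ball (x := x) (r := r)).subset fun z hz => mem_ball_of_abs_re_im_le hz.1.le hz.2.le hr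
  have hunb : ¬ Bornology.IsBounded (D.carrierᶜ \ {z : ℂ | |(z - x).re| < a ∧ |(z - x).im| < b}) := by
    intro h
    exact hXb ((h.union hOb).subset fun z hz => by
      by_cases hzO : z ∈ {z : ℂ | |(z - x).re| < a ∧ |(z - x).im| < b}
      · exact Or.inr hzO
      · exact Or.inl ⟨hz, hzO⟩)
  have hpre := isPreconnected_diff_window hXconn.isPreconnected hXc ha hb hr (compl_carrier_inter_ball hflat)
  refine ⟨hXc.sdiff hO, ⟨?_, hpre⟩, hunb⟩
  by_contra hne
  rw [Set.not_nonempty_iff_eq_empty] at hne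
  rw [hne] at hunb
  exact hunb Bornology.isBounded_empty

/-- **Two windows** (the form the inner-polygon construction consumes: windows below the gate at
`pt 1` and below the root at `pt 0`, far apart): removing from the complement of the carrier two open
windows below two flat pieces whose balls are disjoint leaves a connected unbounded closed set.
[cite: Mccleary2006, Ch. 9 (Jordan curve theorem)] -/
theorem isConnected_compl_carrier_diff_two_windows : ∀ (D : DobrushinDomain) (x₁ x₀ : ℂ) (r₁ r₀ a₁ b₁ a₀ b₀ : ℝ), 0 < a₁ → 0 < b₁ → a₁ + b₁ < r₁ → 0 < a₀ → 0 < b₀ → a₀ + b₀ < r₀ → r₁ + r₀ ≤ dist x₁ x₀ → D.carrier ∩ Metric.ball x₁ r₁ = {z : ℂ | x₁.im < z.im} ∩ Metric.ball x₁ r₁ → D.carrier ∩ Metric.ball x₀ r₀ = {z : ℂ | x₀.im < z.im} ∩ Metric.ball x₀ r₀ → IsConnected ((D.carrierᶜ \ {z : ℂ | |(z - x₁).re| < a₁ ∧ |(z - x₁).im| < b₁}) \ {z : ℂ | |(z - x₀).re| < a₀ ∧ |(z - x₀).im| < b₀}) ∧ ¬ Bornology.IsBounded ((D.carrierᶜ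 \ {z : ℂ | |(z - x₁).re| < a₁ ∧ |(z - x₁).im| < b₁}) \ {z : ℂ | |(z - x₀).re| < a₀ ∧ |(z - x₀).im| < b₀}) := by
  intro D x₁ x₀ r₁ r₀ a₁ b₁ a₀ b₀ ha₁ hb₁ hr₁ ha₀ hb₀ hr₀ hdist hflat₁ hflat₀
  obtain ⟨hXc, hXconn, hXb⟩ := isConnected_compl_carrier_diff_window D x₁ r₁ a₁ b₁ ha₁ hb₁ hr₁ hflat₁
  set X := D.carrierᶜ \ {z : ℂ | |(z - x₁).re| < a₁ ∧ |(z - x₁).im| < b₁} with hXdef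
  set O₀ := {z : ℂ | |(z - x₀).re| < a₀ ∧ |(z - x₀).im| < b₀} with hO₀
  -- the first window misses the second ball
  have hmiss : ∀ z ∈ ball x₀ r₀, z ∉ {z : ℂ | |(z - x₁).re| < a₁ ∧ |(z - x₁).im| < b₁} := by
    intro z hz hz'
    have h1 : dist z x₁ < r₁ := mem_ball_of_abs_re_im_le hz'.1.le hz'.2.le hr₁
    have h2 : dist z x₀ < r₀ := hz
    have := dist_triangle x₁ z x₀
    rw [dist_comm x₁ z] at this
    linarith
  have hflatX : X ∩ ball x₀ r₀ = {z : ℂ | z.im ≤ x₀.im} ∩ ball x₀ r₀ := by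
    rw [← compl_carrier_inter_ball hflat₀]
    ext z
    simp only [hXdef, Set.mem_inter_iff, Set.mem_sdiff]
    exact ⟨fun h => ⟨h.1.1, h.2⟩, fun h => ⟨⟨h.1, hmiss z h.2⟩, h.2⟩⟩
  have hO₀o : IsOpen O₀ := by
    have h1 : Continuous fun z : ℂ => |(z - x₀).re| := by fun_prop
    have h2 : Continuous fun z : ℂ => |(z - x₀).im| := by fun_prop
    exact (isOpen_lt h1 continuous_const).inter (isOpen_lt h2 continuous_const)
  have hO₀b : Bornology.IsBounded O₀ :=
    (Metric.isBounded_ball (x := x₀) (r := r₀)).subset fun z hz => mem_ball_of_abs_re_im_le hz.1.le hz.2.le hr₀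
  have hunb : ¬ Bornology.IsBounded (X \ O₀) := by
    intro h
    exact hXb ((h.union hO₀b).subset fun z hz => by
      by_cases hzO : z ∈ O₀
      · exact Or.inr hzO
      · exact Or.inl ⟨hz, hzO⟩)
  have hpre := isPreconnected_diff_window hXconn.isPreconnected hXc ha₀ hb₀ hr₀ hflatX
  refine ⟨⟨?_, hpre⟩, hunb⟩
  by_contra hne
  rw [Set.not_nonempty_iff_eq_empty] at hne
  rw [hne] at hunb
  exact hunb Bornology.isBounded_empty

end Summit.CriticalPhenomena.SAWScalingLimit.Theorems.PolygonParitySqueeze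

end
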